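/-
Copyright (c) 2026. All rights reserved.
Released under Apache 2.0 license as described in the file LICENSE.
Authors: abc-iut cell, seat abc-iut-L3-t6 (gen 10).
-/
import Literature.GroupTheory.ProPStronglyComplete
import Literature.GroupTheory.InfiniteCharactersNotStronglyComplete
import Mathlib.Order.Atoms.Finite
import HarnessLib

/-!
# The Frattini core of a pro-`p` group is non-generating; it is open in the finitely generated case

L. Ribes, P. Zalesskii, *Profinite Groups* (2nd ed., Springer 2010), §2.8 (Prop. 2.8.10: a subset of a
pro-`p` group generates it topologically iff it does so modulo the Frattini subgroup) and §4.2;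
J. D. Dixon, M. du Sautoy, A. Mann, D. Segal, *Analytic pro-`p` groups* (2nd ed., CUP 1999), Prop. 1.9
(topological Burnside basis theorem) with Thm. 1.17 (Serre).  PROOF-ONLY file (0 definitions, Mathlib +
the tree's `ProPStronglyComplete.lean` / `InfiniteCharactersNotStronglyComplete.lean`), making PUBLIC the
inner step of abc-iut-w6-d067's `exists_finset_dense_of_finite_openNormal_index_eq`
(`ProPStronglyCompleteIffFinitelyGenerated.lean`) in the shape the tempered-`π₁` files consume.

For a profinite group `P` (compact, totally disconnected topological group) which is PRO-`p` (every
continuous finite quotient `P ⧸ U`, `U` open normal, is a `p`-group) write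
`Φ° := ⋂ {N ≤ P open normal of index p}` (spelled out as an `sInf`, no definition introduced):

* `IsPGroup.normal_and_index_eq_of_isCoatom'`, `IsPGroup.exists_normal_index_eq_ge_of_ne_top'` — in a
  finite `p`-group a maximal subgroup is normal of index `p`, so every proper subgroup lies in one;
* `exists_openNormalSubgroup_sup_ne_top_of_isClosed` — a CLOSED proper subgroup `H` of a profinite group
  misses a whole coset of some open normal `U`: `H ⊔ U ≠ ⊤`;
* **`exists_openNormal_index_eq_ge_of_isClosed_of_proP`** — in a pro-`p` group every closed proper
  subgroup lies in an open normal subgroup of index `p`;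
* **`eq_top_of_isClosed_of_sup_frattiniCore_eq_top`** — hence `Φ°` is NON-GENERATING for closed
  subgroups: `H` closed and `H ⊔ Φ° = P` force `H = P` (no finite generation needed);
* `isOpen_frattiniCore_of_proP` — if `P` is moreover topologically finitely generated, `Φ°` is OPEN
  (Serre's theorem `isOpen_of_finiteIndex_of_proP`, abc-iut-w5-d218, and the finiteness of the open normal
  index-`p` subgroups of a strongly complete compact group, abc-iut-w6-d067);
* `exists_isOpen_nongenerating_of_proP` — packaged: a topologically finitely generated pro-`p` group has
  an OPEN normal subgroup `Φ` with `H ⊔ Φ = ⊤ → H = ⊤` for every closed `H` — the «Frattini level» used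
  by `Literature/AnabelianGeometry/SemiGraphs/TemperedMaximalCompactOfProP.lean` ([SemiAnbd] Thm 3.7 (iv)).

Classical material; nothing here refers to [IUTchIII] Cor. 3.12.
[cite: RibesZalesskii2010, §2.8 Prop 2.8.10] [cite: DDMSAnalyticProP1999, Prop 1.9, Thm 1.17]
-/

namespace Literature.GroupTheory

open Topology
open scoped Pointwise

universe u

/-! ### Finite `p`-groups: maximal subgroups are normal of index `p` -/

section FinitePGroup

variable {Q : Type u} [Group Q] [Finite Q] {p : ℕ} [hp : Fact p.Prime]

/-- In a finite `p`-group a maximal subgroup is normal of index `p` (maximal subgroups of nilpotent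
groups are normal; an element of order `p` of the nontrivial `p`-group `Q ⧸ H` generates a subgroup whose
preimage lies strictly above `H`).
-- adapted from Literature/GroupTheory/ProPStronglyCompleteIffFinitelyGenerated.lean (private twin)
[cite: DDMSAnalyticProP1999, §0.4] -/
theorem IsPGroup.normal_and_index_eq_of_isCoatom' (hQ : IsPGroup p Q) {H : Subgroup Q}
    (hH : IsCoatom H) : H.Normal ∧ H.index = p := by
  haveI : Group.IsNilpotent Q := hQ.isNilpotent
  have hN : H.Normal :=
    Subgroup.NormalizerCondition.normal_of_coatom H Group.normalizerCondition_of_isNilpotent hH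
  refine ⟨hN, ?_⟩
  haveI := hN
  haveI : H.FiniteIndex := Subgroup.finiteIndex_of_finite
  obtain ⟨k, hk⟩ := hQ.index H
  have hk0 : k ≠ 0 := by
    rintro rfl
    rw [pow_zero] at hk
    exact hH.1 (Subgroup.index_eq_one.mp hk)
  have hdvd : p ∣ Nat.card (Q ⧸ H) := by
    rw [← Subgroup.index_eq_card, hk]
    exact dvd_pow_self p hk0
  obtain ⟨g, hg⟩ := exists_prime_orderOf_dvd_card' p hdvd
  let K : Subgroup Q := (Subgroup.zpowers g).comap (QuotientGroup.mk' H)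
  have hHK : H ≤ K := by
    intro x hx
    change QuotientGroup.mk' H x ∈ Subgroup.zpowers g
    rw [QuotientGroup.mk'_apply, (QuotientGroup.eq_one_iff x).mpr hx]
    exact one_mem _
  have hne : H ≠ K := by
    intro hHK'
    obtain ⟨x, rfl⟩ := QuotientGroup.mk'_surjective H g
    have hxK : x ∈ K := Subgroup.mem_zpowers _
    rw [← hHK'] at hxK
    have h1 : (QuotientGroup.mk' H x) = 1 := by
      rw [QuotientGroup.mk'_apply]
      exact (QuotientGroup.eq_one_iff x).mpr hxK
    rw [h1, orderOf_one] at hg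
    exact hp.out.one_lt.ne' hg.symm
  have hKtop : K = ⊤ := hH.2 K (lt_of_le_of_ne hHK hne)
  have hztop : Subgroup.zpowers g = ⊤ := by
    apply Subgroup.comap_injective (QuotientGroup.mk'_surjective H)
    rw [Subgroup.comap_top]
    exact hKtop
  rw [Subgroup.index_eq_card, ← Subgroup.card_top (G := Q ⧸ H), ← hztop, Nat.card_zpowers, hg]

/-- In a finite `p`-group every proper subgroup lies in a NORMAL subgroup of index `p` (a maximal
subgroup above it). [cite: DDMSAnalyticProP1999, §0.4] -/
theorem IsPGroup.exists_normal_index_eq_ge_of_ne_top' (hQ : IsPGroup p Q) {L : Subgroup Q}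
    (hL : L ≠ ⊤) : ∃ M : Subgroup Q, M.Normal ∧ M.index = p ∧ L ≤ M := by
  obtain ⟨M, hM, hLM⟩ := (eq_top_or_exists_le_coatom L).resolve_left hL
  obtain ⟨hMn, hMi⟩ := IsPGroup.normal_and_index_eq_of_isCoatom' hQ hM
  exact ⟨M, hMn, hMi, hLM⟩

end FinitePGroup

/-! ### Profinite groups: a closed proper subgroup misses a coset of an open normal subgroup -/

section Profinite

variable {P : Type u} [Group P] [TopologicalSpace P] [IsTopologicalGroup P] [CompactSpace P]
  [TotallyDisconnectedSpace P]

/-- In a profinite group a CLOSED proper subgroup `H` misses a whole coset `gU` of some open normal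
subgroup `U` (the open normal subgroups form a neighbourhood basis of `1`), so that `H ⊔ U ≠ ⊤`.
[cite: RibesZalesskii2010, §2.1] -/
theorem exists_openNormalSubgroup_sup_ne_top_of_isClosed {H : Subgroup P}
    (hHc : IsClosed (H : Set P)) (hH : H ≠ ⊤) :
    ∃ U : OpenNormalSubgroup P, H ⊔ (U : Subgroup P) ≠ ⊤ := by
  obtain ⟨g, hg⟩ : ∃ g : P, g ∉ H := by
    by_contra hall
    push Not at hall
    exact hH (eq_top_iff.mpr fun x _ => hall x)
  have h1 : (1 : P) ∈ (fun x => g * x) ⁻¹' (H : Set P)ᶜ := by simpa using hg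
  obtain ⟨U, hU⟩ := ProfiniteGrp.exist_openNormalSubgroup_sub_open_nhds_of_one
    (hHc.isOpen_compl.preimage (continuous_const.mul continuous_id)) h1
  refine ⟨U, fun htop => ?_⟩
  have hgK : g ∈ ((H ⊔ (U : Subgroup P) : Subgroup P) : Set P) := by
    rw [htop]; exact Subgroup.mem_top g
  rw [Subgroup.mul_normal] at hgK
  obtain ⟨h, hh, u, hu, hhu⟩ := Set.mem_mul.mp hgK
  have hu' : u⁻¹ ∈ (fun x => g * x) ⁻¹' (H : Set P)ᶜ := hU ((U : Subgroup P).inv_mem hu)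
  apply hu'
  change g * u⁻¹ ∈ (H : Set P)
  rw [← hhu, mul_inv_cancel_right]
  exact hh

end Profinite

/-! ### Pro-`p` groups: the Frattini core `Φ°` -/

section ProP

variable {P : Type u} [Group P] [TopologicalSpace P] [IsTopologicalGroup P] [CompactSpace P]
  [TotallyDisconnectedSpace P] {p : ℕ} [Fact p.Prime]

/-- **In a pro-`p` group every closed proper subgroup lies in an open normal subgroup of index `p`.**
If `H` is closed and proper it misses a coset of an open normal `U`; in the finite `p`-group `P ⧸ U` the
proper subgroup `(H ⊔ U) ⧸ U` lies in a maximal subgroup, normal of index `p`, whose preimage is the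
required subgroup. [cite: RibesZalesskii2010, §2.8 Prop 2.8.10] [cite: DDMSAnalyticProP1999, Prop 1.9] -/
theorem exists_openNormal_index_eq_ge_of_isClosed_of_proP
    (hP : ∀ U : OpenNormalSubgroup P, IsPGroup p (P ⧸ (U : Subgroup P)))
    {H : Subgroup P} (hHc : IsClosed (H : Set P)) (hH : H ≠ ⊤) :
    ∃ M : Subgroup P, M.Normal ∧ IsOpen (M : Set P) ∧ M.index = p ∧ H ≤ M := by
  obtain ⟨U, hKtop⟩ := exists_openNormalSubgroup_sup_ne_top_of_isClosed hHc hH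
  set K : Subgroup P := H ⊔ (U : Subgroup P) with hK
  let π : P →* P ⧸ (U : Subgroup P) := QuotientGroup.mk' (U : Subgroup P)
  have hπ : Function.Surjective π := QuotientGroup.mk'_surjective _
  haveI : Finite (P ⧸ (U : Subgroup P)) :=
    Subgroup.quotient_finite_of_isOpen (U : Subgroup P) U.isOpen
  have hKU : (U : Subgroup P) ≤ K := le_sup_right
  have hcomap : (K.map π).comap π = K := by
    rw [Subgroup.comap_map_eq, QuotientGroup.ker_mk', sup_eq_left.mpr hKU]
  have hL : K.map π ≠ ⊤ := by
    intro htop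
    apply hKtop
    rw [← hcomap, htop, Subgroup.comap_top]
  obtain ⟨Mbar, hMn, hMi, hLM⟩ := IsPGroup.exists_normal_index_eq_ge_of_ne_top' (hP U) hL
  haveI := hMn
  refine ⟨Mbar.comap π, inferInstance, ?_, ?_, ?_⟩
  · exact Subgroup.isOpen_mono (hKU.trans (hcomap ▸ Subgroup.comap_mono hLM)) U.isOpen
  · rw [Subgroup.index_comap_of_surjective Mbar hπ, hMi]
  · exact le_sup_left.trans (hcomap ▸ Subgroup.comap_mono hLM)

omit [TopologicalSpace P] [IsTopologicalGroup P] [CompactSpace P] [TotallyDisconnectedSpace P] in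
/-- An open normal subgroup of index `p` is proper. [cite: DDMSAnalyticProP1999, Prop 1.9] -/
theorem ne_top_of_index_eq_prime {M : Subgroup P} (hM : M.index = p) : M ≠ ⊤ := by
  rintro rfl
  rw [Subgroup.index_top] at hM
  exact (Fact.out : p.Prime).one_lt.ne hM

/-- **The Frattini core is non-generating for closed subgroups** (Burnside basis theorem, qualitative
half; NO finite generation assumed): in a pro-`p` group, a CLOSED subgroup `H` with
`H ⊔ ⋂ {N open normal of index p} = P` is all of `P`. [cite: RibesZalesskii2010, §2.8 Prop 2.8.10] -/
theorem eq_top_of_isClosed_of_sup_frattiniCore_eq_top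
    (hP : ∀ U : OpenNormalSubgroup P, IsPGroup p (P ⧸ (U : Subgroup P)))
    {H : Subgroup P} (hHc : IsClosed (H : Set P))
    (hsup : H ⊔ sInf {N : Subgroup P | N.Normal ∧ IsOpen (N : Set P) ∧ N.index = p} = ⊤) :
    H = ⊤ := by
  by_contra hH
  obtain ⟨M, hMn, hMo, hMi, hHM⟩ := exists_openNormal_index_eq_ge_of_isClosed_of_proP hP hHc hH
  have hΦM : sInf {N : Subgroup P | N.Normal ∧ IsOpen (N : Set P) ∧ N.index = p} ≤ M :=
    sInf_le ⟨hMn, hMo, hMi⟩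
  exact ne_top_of_index_eq_prime hMi (top_le_iff.mp (hsup ▸ sup_le hHM hΦM))

/-- Product-set form of the non-generation: if the closed subgroup `H` meets every coset of the
Frattini core, i.e. `H · Φ° = P` as sets, then `H = P`. [cite: RibesZalesskii2010, §2.8 Prop 2.8.10] -/
theorem eq_top_of_isClosed_of_mul_frattiniCore_eq_univ
    (hP : ∀ U : OpenNormalSubgroup P, IsPGroup p (P ⧸ (U : Subgroup P)))
    {H : Subgroup P} (hHc : IsClosed (H : Set P))
    (hmul : (H : Set P) * ((sInf {N : Subgroup P | N.Normal ∧ IsOpen (N : Set P) ∧ N.index = p} :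
      Subgroup P) : Set P) = Set.univ) : H = ⊤ := by
  refine eq_top_of_isClosed_of_sup_frattiniCore_eq_top hP hHc (eq_top_iff.mpr fun x _ => ?_)
  have hx : x ∈ (H : Set P) *
      ((sInf {N : Subgroup P | N.Normal ∧ IsOpen (N : Set P) ∧ N.index = p} : Subgroup P) : Set P) :=
    hmul ▸ Set.mem_univ x
  obtain ⟨h, hh, k, hk, rfl⟩ := Set.mem_mul.mp hx
  exact mul_mem (Subgroup.mem_sup_left hh) (Subgroup.mem_sup_right hk)

omit [IsTopologicalGroup P] [CompactSpace P] [TotallyDisconnectedSpace P] [Fact p.Prime] in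
/-- The Frattini core is a normal subgroup. [cite: DDMSAnalyticProP1999, Prop 1.9] -/
theorem normal_frattiniCore :
    (sInf {N : Subgroup P | N.Normal ∧ IsOpen (N : Set P) ∧ N.index = p}).Normal := by
  refine ⟨fun x hx g => ?_⟩
  rw [Subgroup.mem_sInf] at hx ⊢
  intro N hN
  haveI := hN.1
  exact hN.1.conj_mem x (hx N hN) g

/-- **The Frattini core of a topologically finitely generated pro-`p` group is open**: finite-index
subgroups are open (Serre, abc-iut-w5-d218's `isOpen_of_finiteIndex_of_proP`), so there are only finitely
many open normal subgroups of index `p` (abc-iut-w6-d067's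
`finite_openNormal_index_eq_of_forall_finiteIndex_isOpen`) and their intersection is open.
[cite: DDMSAnalyticProP1999, Prop 1.9, Thm 1.17] -/
theorem isOpen_frattiniCore_of_proP
    (hP : ∀ U : OpenNormalSubgroup P, IsPGroup p (P ⧸ (U : Subgroup P)))
    (hfg : ∃ S : Finset P, Dense ((Subgroup.closure (S : Set P) : Subgroup P) : Set P)) :
    IsOpen ((sInf {N : Subgroup P | N.Normal ∧ IsOpen (N : Set P) ∧ N.index = p} : Subgroup P) :
      Set P) := by
  have hfin : Set.Finite {N : Subgroup P | N.Normal ∧ IsOpen (N : Set P) ∧ N.index = p} :=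
    finite_openNormal_index_eq_of_forall_finiteIndex_isOpen fun V hV => by
      haveI := hV
      exact isOpen_of_finiteIndex_of_proP hP hfg V
  rw [Subgroup.coe_sInf]
  exact hfin.isOpen_biInter fun N hN => hN.2.1

/-- **Packaged «Frattini level»**: a topologically finitely generated pro-`p` group has an OPEN normal
subgroup `Φ` which is non-generating for closed subgroups — `H` closed and `H ⊔ Φ = ⊤` force `H = ⊤`
(take `Φ = Φ°`).  This is the group-theoretic input of «verticial ⇒ maximal compact» at a vertex with
pro-`p` vertex group ([SemiAnbd] Thm 3.7 (iv); `TemperedMaximalCompactOfProP.lean`).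
[cite: RibesZalesskii2010, §2.8 Prop 2.8.10] [cite: DDMSAnalyticProP1999, Prop 1.9] -/
theorem exists_isOpen_nongenerating_of_proP
    (hP : ∀ U : OpenNormalSubgroup P, IsPGroup p (P ⧸ (U : Subgroup P)))
    (hfg : ∃ S : Finset P, Dense ((Subgroup.closure (S : Set P) : Subgroup P) : Set P)) :
    ∃ Φ : Subgroup P, IsOpen (Φ : Set P) ∧ Φ.Normal ∧
      ∀ H : Subgroup P, IsClosed (H : Set P) → H ⊔ Φ = ⊤ → H = ⊤ :=
  ⟨_, isOpen_frattiniCore_of_proP hP hfg, normal_frattiniCore, fun _ hHc hsup =>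
    eq_top_of_isClosed_of_sup_frattiniCore_eq_top hP hHc hsup⟩

/-- The same with topological finite generation in the `topologicalClosure` spelling of the cell's
`IsCoherent` / `IsTopologicallyFinitelyGenerated`. [cite: DDMSAnalyticProP1999, Prop 1.9] -/
theorem exists_isOpen_nongenerating_of_proP'
    (hP : ∀ U : OpenNormalSubgroup P, IsPGroup p (P ⧸ (U : Subgroup P)))
    (hfg : ∃ S : Finset P, (Subgroup.closure (S : Set P)).topologicalClosure = ⊤) :
    ∃ Φ : Subgroup P, IsOpen (Φ : Set P) ∧ Φ.Normal ∧
      ∀ H : Subgroup P, IsClosed (H : Set P) → H ⊔ Φ = ⊤ → H = ⊤ := by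
  refine exists_isOpen_nongenerating_of_proP hP ?_
  obtain ⟨S, hS⟩ := hfg
  refine ⟨S, ?_⟩
  rw [dense_iff_closure_eq, ← Subgroup.topologicalClosure_coe, hS, Subgroup.coe_top]

end ProP

end Literature.GroupTheory
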